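/-
Copyright (c) 2026. All rights reserved.
Released under Apache 2.0 license as described in the file LICENSE.
Authors: abc-iut cell, prover seat abc-iut-w5-d097 (wave 5), over the statements of abc-iut-L4-t3.
-/
import Mathlib.CategoryTheory.InducedCategory
import Mathlib.CategoryTheory.Types.Basic
import Literature.AnabelianGeometry.AbsoluteAnabelian.LogFrobeniusObservablesTelecore
import Literature.AnabelianGeometry.AbsoluteAnabelian.LogFrobeniusContactProofs
import HarnessLib

/-!
# [AbsTopIII] Corollary 5.5 (iii), last sentence (`Cor55ObservablesCompatible` = FACT-LIST F-3081,
# `Cor55ObservablesTelecoreCompatible` = F-3757): kernel NON-VACUITY — both HOLD at the empty setting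

S. Mochizuki, *Topics in absolute anabelian geometry III: global reconstruction algorithms*,
J. Math. Sci. Univ. Tokyo 22 (2015) 939–1156 [MochizukiAbsTopIII2015]; locators `p.N` = pages of the author's manuscript
(`paper:url-5493eb38cbb7`): Def 3.5 (ii)–(iv) pp. 75–76, Cor 5.5 (i)–(iii) pp. 130–131 ("the families of homotopies that
constitute `S_log` and `S_log⊞` are compatible with one another as well as with the families of homotopies that constitute
the core and telecore structures of (i), (ii)").

PROOF-ONLY companion (theorems only; nothing restated) of abc-iut-L4-t3's `LogFrobeniusObservables.lean`
(`Cor55ObservablesCompatible` = F-3081: one family on `D•⊢` realising the three cores of Cor 5.5 (i), the observables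
`S_log⊞_v` and the `TS`-valued `S_log_v`) and `LogFrobeniusObservablesTelecore.lean` (`Cor55ObservablesTelecoreCompatible` =
F-3757: the same inside the telecore diagram `D_{An•}` together with the telecore `𝔗_{An•}`), continuing this seat's
`LogFrobeniusObservablesTSNotForall.lean` (p430382: the universal closures of F-3080 / F-3081 / F-3757 are REFUTED) and
`LogFrobeniusNotSimCompatIndependence.lean` (p432321: the empty-setting technique):

* `exists_cor55ObservablesCompatible_and_telecoreCompatible` — over every NONEMPTY index set there are `L`, `T` at which
  BOTH F-3081 and F-3757 hold: the EMPTY setting (every row of `D•`/`D⊢` the empty large category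
  `InducedCategory (Type u) PEmpty.elim`, every structure functor the identity), where every natural transformation between
  path functors is unique, so the family of ALL co-verticial pairs (on `D•⊢`, resp. on `D_{An•}`) contains the cores of
  Cor 5.5 (i) (all pairs ending at the core vertex; `reach_e5` / `reach_an` / `reach_e7` of abc-iut-L4-t15 give the core
  condition of Def 3.5 (iii)), abc-iut-L4-t5's telecore `𝔗_{An•}` (`cor55TelecoreContact_holds`) and the observables (all
  pairs ending at the observation vertex; the printed conditions on components are vacuous);
* `exists_cor55ObservablesCompatible` (F-3081), `exists_cor55ObservablesTelecoreCompatible` (F-3757): with p430382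
  (`not_forall_cor55ObservablesCompatible`, `not_forall_cor55ObservablesTelecoreCompatible`) both rows are INDEPENDENT of
  the interface `LogFrobeniusSetting` / `TSHomotopies` — assumptions on `(L, T)` quoting print, whose interface-level content
  at the places where they can fail is the `TS` ι-diamond law of Def 5.4 (iii) (p429468).

HONEST LABEL: the empty setting is the MOST degenerate model of the interface (no objects anywhere); calibration of the
typed statements only.  Refereed pre-IUT material; nothing here bears on [IUTchIII] Cor. 3.12; OUR kernel check; no side
taken.
-/

set_option autoImplicit false

universe u

open CategoryTheory Quiver

namespace Literature.AnabelianGeometry.AbsoluteAnabelian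

/-! ## Empty categories: functors and natural transformations out of them are unique -/

section EmptyLemmas

variable {A : Type*} [Category A] {B : Type*} [Category B]

/-- Two functors out of an empty category are equal. [folklore] -/
private theorem functor_eq_of_isEmpty' (hA : IsEmpty A) (F G : A ⥤ B) : F = G :=
  Functor.ext (fun X => hA.elim X) (fun X => hA.elim X)

/-- Two natural transformations between functors out of an empty category are equal. [folklore] -/
private theorem natTrans_eq_of_isEmpty' (hA : IsEmpty A) {F G : A ⥤ B} (α β : F ⟶ G) : α = β :=
  NatTrans.ext (funext fun X => hA.elim X)

/-- Natural transformations between functors out of an empty category are heterogeneously equal. [folklore] -/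
private theorem heq_natTrans_of_isEmpty' (hA : IsEmpty A) {F G F' G' : A ⥤ B} (α : F ⟶ G) (β : F' ⟶ G') :
    HEq α β := by
  obtain rfl := functor_eq_of_isEmpty' hA F F'
  obtain rfl := functor_eq_of_isEmpty' hA G G'
  exact heq_of_eq (natTrans_eq_of_isEmpty' hA α β)

end EmptyLemmas

namespace DiagramOfCategories

variable {V : Type u} [Quiver.{u} V] (D : DiagramOfCategories.{u, u + 1, u} V)

/-- On a diagram all of whose categories are EMPTY, every saturated set of co-verticial pairs is the boundary set of a
family of homotopies (Def 3.5 (ii); the homotopies are the unique natural transformations).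
[cite: MochizukiAbsTopIII2015, Definition 3.5 (ii) p.75] -/
private theorem exists_homotopyFamily_of_isEmpty' (hD : ∀ a : V, IsEmpty (D.obj a))
    (T : ∀ ⦃a b : V⦄, Path a b → Path a b → Prop) (hT : IsSaturated T) :
    ∃ H : D.HomotopyFamily, ∀ ⦃a b : V⦄ (p q : Path a b), H.E p q ↔ T p q :=
  ⟨{ E := T
     isSaturated := hT
     η := fun ⦃a _ p q⦄ _ => eqToHom (functor_eq_of_isEmpty' (hD a) (D.pathFunctor p) (D.pathFunctor q))
     η_refl := fun ⦃a _ _⦄ _ => natTrans_eq_of_isEmpty' (hD a) _ _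
     η_trans := fun ⦃a _ _ _ _⦄ _ _ => natTrans_eq_of_isEmpty' (hD a) _ _
     η_whisker := fun ⦃_ _ c _ _ _⦄ _ _ _ => natTrans_eq_of_isEmpty' (hD c) _ _ }, fun _ _ _ _ => Iff.rfl⟩

/-- In an observable shape (no telecore edges) every path out of the observation vertex stays there.
[cite: MochizukiAbsTopIII2015, Definition 3.5 (iii) p.75] -/
private theorem eq_obs_of_path_obs' (X : ExtShape.{u} V) (hX : ∀ a, IsEmpty (X.J a)) {c : X.Vertex}
    (r : Path X.obs c) : c = X.obs := by
  induction r with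
  | nil => rfl
  | cons r e ih =>
    subst ih
    rename_i c
    cases c with
    | base a => exact ((hX a).false e).elim
    | obs => rfl

/-- Hence the co-verticial pairs ENDING at the observation vertex form a saturated set (§0 (a)–(e)).
[cite: MochizukiAbsTopIII2015, Section 0 p.26] -/
private theorem isSaturated_endsAtObs' (X : ExtShape.{u} V) (hX : ∀ a, IsEmpty (X.J a)) :
    IsSaturated (V := X.Vertex) (fun _ b _ _ => b = X.obs) where
  refl_left _ _ _ _ h := h
  refl_right _ _ _ _ h := h
  trans _ _ _ _ _ h _ := h
  precomp _ _ _ _ _ h _ := h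
  postcomp _ b c _ _ h r := by
    subst h
    exact eq_obs_of_path_obs' X hX r

end DiagramOfCategories

namespace LogFrobeniusSetting

variable (Vmod : Type u) (isArc : Vmod → Bool)

/-- **F-3081 and F-3757 HOLD at the EMPTY setting**: over every nonempty index set there are `L`, `T` with
`Cor55ObservablesCompatible T` (one family on `D•⊢` realising the three cores of (i), the `S_log⊞_v` and the `S_log_v`) and
`Cor55ObservablesTelecoreCompatible T` (the same inside `D_{An•}` with abc-iut-L4-t5's telecore `𝔗_{An•}`), every natural
transformation on the empty setting being unique.  DEGENERATE calibration witness.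
[cite: MochizukiAbsTopIII2015, Cor 5.5 (iii) p. 131] -/
theorem exists_cor55ObservablesCompatible_and_telecoreCompatible [Nonempty Vmod] :
    ∃ (L : LogFrobeniusSetting Vmod isArc) (T : L.TSHomotopies),
      L.Cor55ObservablesCompatible T ∧ L.Cor55ObservablesTelecoreCompatible T := by
  -- an EMPTY large category and the empty setting on it
  obtain ⟨C, _instC, hC⟩ : ∃ (C : Type (u + 1)) (_ : Category.{u} C), IsEmpty C :=
    ⟨InducedCategory (Type u) (PEmpty.elim : PEmpty.{u + 2} → Type u), inferInstance,
      inferInstanceAs (IsEmpty PEmpty.{u + 2})⟩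
  let L₀ : LogFrobeniusSetting Vmod isArc :=
    { X := C
      E := C
      proj := 𝟭 C
      log := 𝟭 C
      logIsoId := Iso.refl _
      logOver := Iso.refl _
      Nplus := fun _ => C
      N := fun _ => C
      forget := fun _ => 𝟭 C
      toE := fun _ => 𝟭 C
      lam := fun _ _ => 𝟭 C
      lamOver := fun _ _ => Iso.refl _
      lam_spaceLink_eq_postLog := fun _ => rfl
      iota := fun _ _ _ _ => eqToHom (functor_eq_of_isEmpty' hC _ _)
      An := C
      κAn := CategoryTheory.Equivalence.refl
      φAn := 𝟭 C
      φAn_isEquivalence := inferInstance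
      ηAn := Iso.refl _
      κAn₂ := CategoryTheory.Equivalence.refl
      Emono := C
      monoAn := 𝟭 C
      NmonoPlus := fun _ => C
      Nmono := fun _ => C
      forgetMono := fun _ => 𝟭 C
      toEmono := fun _ => 𝟭 C
      monoNplus := fun _ => 𝟭 C
      monoN := fun _ => 𝟭 C
      monoHomotopy := fun _ => Iso.refl _
      AnMono := C
      κAnMono := CategoryTheory.Equivalence.refl
      ψAnMono := fun _ _ => 𝟭 C }
  let T₀ : L₀.TSHomotopies :=
    { iota := fun _ _ _ _ => eqToHom (functor_eq_of_isEmpty' hC _ _)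
      iota_toTS := fun _ _ _ _ => natTrans_eq_of_isEmpty' hC _ _ }
  -- every vertex category of `D•⊢` and of the presentations is empty
  have hV : ∀ x : DVertex Vmod isArc, IsEmpty (x.category L₀) := by
    intro x; cases x <;> exact hC
  have hExt : ∀ (P : DVertex Vmod isArc → Prop) (x : DVertex Vmod isArc) (a : (obsShape P x).Vertex),
      IsEmpty (((L₀.subdiagram P).extend (L₀.obsExt P x)).obj a) := by
    intro P x a
    cases a with
    | base a => exact hV a.1
    | obs => exact hV x
  -- the family of ALL co-verticial pairs of `D•⊢`
  obtain ⟨K, hK⟩ := DiagramOfCategories.exists_homotopyFamily_of_isEmpty' L₀.diagram hV covert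
    isSymmSaturated_covert.toIsSaturated
  -- cores: all pairs ending at the core vertex
  have core : ∀ (P : DVertex Vmod isArc → Prop) (x : DVertex Vmod isArc)
      (hreach : ∀ a : DSub P, Nonempty (Path ((obsShape P x).base a) (obsShape P x).obs)),
      ∃ (H : ((L₀.subdiagram P).extend (L₀.obsExt P x)).HomotopyFamily)
        (hH : ∀ ⦃a b : (obsShape P x).Vertex⦄ ⦃p q : Path a b⦄, H.E p q → b = (obsShape P x).obs),
        (DiagramOfCategories.Observable.mk (obsShape P x) (fun _ => (inferInstance : IsEmpty PEmpty.{u + 1}))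
          (L₀.obsExt P x) H hH).IsCore ∧ L₀.CompatibleIn K H := by
    intro P x hreach
    obtain ⟨H, hH⟩ := DiagramOfCategories.exists_homotopyFamily_of_isEmpty' _ (hExt P x) _
      (DiagramOfCategories.isSaturated_endsAtObs' (obsShape P x) (fun _ => (inferInstance : IsEmpty PEmpty.{u + 1})))
    refine ⟨H, fun _ _ _ _ h => (hH _ _).mp h, ⟨fun _ p q => (hH p q).mpr rfl, hreach⟩, fun a b p q h => ?_⟩
    refine ⟨(hK _ _).mpr trivial, ?_⟩
    obtain rfl : b = _ := (hH p q).mp h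
    cases a with
    | base a => exact heq_natTrans_of_isEmpty' (hV a.1) _ _
    | obs => exact heq_natTrans_of_isEmpty' (hV x) _ _
  -- observables: all pairs ending at the observation vertex; printed component conditions vacuous
  have obsP : ∀ v : Vmod, ∃ H : (L₀.logDiagramPlus v).HomotopyFamily, L₀.IsLogObservablePlus v H ∧
      (∀ ⦃a b⦄ (p q : Path a b), H.E p q ↔ b = (logShapePlus (isArc := isArc) v).obs) ∧ L₀.CompatibleIn K H := by
    intro v
    obtain ⟨H, hH⟩ := DiagramOfCategories.exists_homotopyFamily_of_isEmpty' (L₀.logDiagramPlus v)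
      (hExt (DVertex.InFirstRows 2) (.nplus v)) _
      (DiagramOfCategories.isSaturated_endsAtObs' (logShapePlus (isArc := isArc) v)
        (fun _ => (inferInstance : IsEmpty PEmpty.{u + 1})))
    refine ⟨H, ⟨fun _ _ _ _ h => (hH _ _).mp h, fun ν₁ ν₂ ε h₁ h₂ => ⟨(hH _ _).mpr rfl, fun X₀ => (hC.false X₀).elim⟩,
      fun ν₁ ν₂ ε h₁ h₂ hsl n => ⟨(hH _ _).mpr rfl, fun X₀ => (hC.false X₀).elim⟩⟩, hH, fun a b p q h => ?_⟩
    refine ⟨(hK _ _).mpr trivial, ?_⟩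
    obtain rfl : b = _ := (hH p q).mp h
    cases a with
    | base a => exact heq_natTrans_of_isEmpty' (hV a.1) _ _
    | obs => exact heq_natTrans_of_isEmpty' (hV (.nplus v)) _ _
  have obsT : ∀ v : Vmod, ∃ H : (L₀.logDiagramTS v).HomotopyFamily, L₀.IsLogObservableTS T₀ v H ∧
      (∀ ⦃a b⦄ (p q : Path a b), H.E p q ↔ b = (logShapeTS (isArc := isArc) v).obs) ∧ L₀.CompatibleIn K H := by
    intro v
    obtain ⟨H, hH⟩ := DiagramOfCategories.exists_homotopyFamily_of_isEmpty' (L₀.logDiagramTS v)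
      (hExt (InPortionThree v) (.nv v)) _
      (DiagramOfCategories.isSaturated_endsAtObs' (logShapeTS (isArc := isArc) v)
        (fun _ => (inferInstance : IsEmpty PEmpty.{u + 1})))
    refine ⟨H, ⟨fun _ _ _ _ h => (hH _ _).mp h, fun ν₁ ν₂ ε h₁ h₂ => ⟨(hH _ _).mpr rfl, fun X₀ => (hC.false X₀).elim⟩,
      fun ν₁ ν₂ ε h₁ h₂ hsl n => ⟨(hH _ _).mpr rfl, fun X₀ => (hC.false X₀).elim⟩⟩, hH, fun a b p q h => ?_⟩
    refine ⟨(hK _ _).mpr trivial, ?_⟩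
    obtain rfl : b = _ := (hH p q).mp h
    cases a with
    | base a => exact heq_natTrans_of_isEmpty' (hV a.1) _ _
    | obs => exact heq_natTrans_of_isEmpty' (hV (.nv v)) _ _
  choose Hplus hHplus hEplus hCplus using obsP
  choose Hts hHts hEts hCts using obsT
  refine ⟨L₀, T₀, ?_, ?_⟩
  · -- F-3081: the three cores and all observables inside the all-pairs family `K` of `D•⊢`
    obtain ⟨H4, hH4, hc4, hK4⟩ := core (DVertex.InFirstRows 4) .e5 reach_e5
    obtain ⟨H5, hH5, hc5, hK5⟩ := core (DVertex.InFirstRows 5) .an reach_an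
    obtain ⟨H6, hH6, hc6, hK6⟩ := core (DVertex.InFirstRows 6) .e7 reach_e7
    exact ⟨K, ⟨⟨H4, hH4, hc4, hK4⟩, ⟨H5, hH5, hc5, hK5⟩, ⟨H6, hH6, hc6, hK6⟩,
      fun v => ⟨Hplus v, hHplus v, hCplus v⟩⟩, fun v => ⟨Hts v, hHts v, hCts v⟩⟩
  · -- F-3757: L4-t5's telecore `𝔗_{An•}`, the `ℰ•`-core and all observables inside the all-pairs family of `D_{An•}`
    obtain ⟨H, hH, hc, Tl, hJ, htel, -, -, -⟩ := L₀.cor55TelecoreContact_holds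
    have hTel : ∀ a : (anTelecoreShape (isArc := isArc) Tl.J).Vertex,
        IsEmpty ((L₀.anTelecoreDiagram Tl.J Tl.telMap).obj a) := by
      intro a
      cases a with
      | base a => exact hV a.1
      | obs => exact hC
    obtain ⟨K', hK'⟩ := DiagramOfCategories.exists_homotopyFamily_of_isEmpty' (L₀.anTelecoreDiagram Tl.J Tl.telMap) hTel
      covert isSymmSaturated_covert.toIsSaturated
    obtain ⟨H5, hH5⟩ := DiagramOfCategories.exists_homotopyFamily_of_isEmpty' _ (hExt (DVertex.InFirstRows 4) .e5) _
      (DiagramOfCategories.isSaturated_endsAtObs' (obsShape (DVertex.InFirstRows (isArc := isArc) 4) DVertex.e5)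
        (fun _ => (inferInstance : IsEmpty PEmpty.{u + 1})))
    refine ⟨H, hH, hc, Tl, hJ, htel, H5, fun _ _ _ _ h => (hH5 _ _).mp h, Hplus, Hts, K',
      ⟨fun _ p q => (hH5 p q).mpr rfl, reach_e5⟩, fun v => ⟨hHplus v, hHts v⟩, ?_, ?_, ?_⟩
    · -- `𝔍 ⊆ K'`
      intro a b p q h
      exact ⟨(hK' p q).mpr trivial, natTrans_eq_of_isEmpty' (hTel a) _ _⟩
    · -- the `ℰ•`-core embeds along `embE5`
      intro a b p q h
      refine ⟨(hK' _ _).mpr trivial, ?_⟩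
      obtain rfl : b = _ := (hH5 p q).mp h
      cases a with
      | base a => exact heq_natTrans_of_isEmpty' (hV a.1) _ _
      | obs => exact heq_natTrans_of_isEmpty' (hV .e5) _ _
    · -- the observables embed along `embPlus` / `embTS`
      intro v
      refine ⟨fun a b p q h => ⟨(hK' _ _).mpr trivial, ?_⟩, fun a b p q h => ⟨(hK' _ _).mpr trivial, ?_⟩⟩
      · obtain rfl : b = _ := (hEplus v p q).mp h
        cases a with
        | base a => exact heq_natTrans_of_isEmpty' (hV a.1) _ _
        | obs => exact heq_natTrans_of_isEmpty' (hV (.nplus v)) _ _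
      · obtain rfl : b = _ := (hEts v p q).mp h
        cases a with
        | base a => exact heq_natTrans_of_isEmpty' (hV a.1) _ _
        | obs => exact heq_natTrans_of_isEmpty' (hV (.nv v)) _ _

/-- **F-3081 `Cor55ObservablesCompatible` is SATISFIABLE with the interface** over every nonempty index set; with
`not_forall_cor55ObservablesCompatible` (p430382) it is INDEPENDENT of the interface — a named hypothesis quoting print.
[cite: MochizukiAbsTopIII2015, Cor 5.5 (iii) p. 131] -/
theorem exists_cor55ObservablesCompatible [Nonempty Vmod] :
    ∃ (L : LogFrobeniusSetting Vmod isArc) (T : L.TSHomotopies), L.Cor55ObservablesCompatible T := by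
  obtain ⟨L, T, h, -⟩ := exists_cor55ObservablesCompatible_and_telecoreCompatible Vmod isArc
  exact ⟨L, T, h⟩

/-- **F-3757 `Cor55ObservablesTelecoreCompatible` is SATISFIABLE with the interface** over every nonempty index set; with
`not_forall_cor55ObservablesTelecoreCompatible` (p430382) it is INDEPENDENT of the interface — a named hypothesis quoting
print. [cite: MochizukiAbsTopIII2015, Cor 5.5 (iii) p. 131] -/
theorem exists_cor55ObservablesTelecoreCompatible [Nonempty Vmod] :
    ∃ (L : LogFrobeniusSetting Vmod isArc) (T : L.TSHomotopies), L.Cor55ObservablesTelecoreCompatible T := by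
  obtain ⟨L, T, -, h⟩ := exists_cor55ObservablesCompatible_and_telecoreCompatible Vmod isArc
  exact ⟨L, T, h⟩

end LogFrobeniusSetting

end Literature.AnabelianGeometry.AbsoluteAnabelian
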